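import Mathlib
import Summits.Ventures.HodgeRepro2.T6A1DictRat

/-!
# T6A1BaseChange — base change from `ℚ` to `ℂ`: internal direct sums, the canonical rational structure
(host-free; Tier-6 sub-goal A1, Layer III, owner t6-p1; the lead's rulings STATUS ll. 5320 / 10912)

The (S4) object of `T6Host` v3 lives on the rational Betti cohomology `H¹(·, ℚ)` and its complexification
`ℂ ⊗[ℚ] H¹(·, ℚ)`; the dictionary of A1 lives on `ℂ`-vector spaces. This file is the pure linear algebra of
that base change: `mk_one_injective` (`q ↦ 1 ⊗ q` is injective, `ℂ` flat over `ℚ`),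
`mem_baseChange_mk_one_iff` (`1 ⊗ q ∈ p.baseChange ℂ ↔ q ∈ p`), `isInternal_baseChange` (an internal direct
sum of `ℚ`-subspaces stays internal after base change — through the projections of the decomposition), and the
CANONICAL RATIONAL STRUCTURE `ratHC act : T6A1DictRat.RatStructure (bcAct act)` of `ℂ ⊗[ℚ] Q` (rational classes
`ratC = range (q ↦ 1 ⊗ q)`; no display: `ℂ ⊗[ℚ] ratC ≃ ℂ ⊗[ℚ] Q` is the identity on pure tensors), with the
compatibilities `baseChange_mem_ratC` (pull-backs preserve rational classes) and `ratSmul_mem_ratC`.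
No host carrier, no display. §8(d): uses an L-value-free non-vanishing device: NO.
-/

noncomputable section

open scoped TensorProduct

namespace Summit.Ventures.HodgeRepro2.T6.A1BaseChange

open A1DictRat

/-! ## 1. Generic: base change of an internal direct sum; the canonical rational structure -/

section generic

variable {Q : Type*} [AddCommGroup Q] [Module ℚ Q]

/-- `q ↦ 1 ⊗ q` is injective (`ℂ` is flat over `ℚ`). -/
theorem mk_one_injective : Function.Injective (TensorProduct.mk ℚ ℂ Q 1) := by
  have h1 : Function.Injective ((Algebra.linearMap ℚ ℂ).rTensor Q) :=
    Module.Flat.rTensor_preserves_injective_linearMap _ (algebraMap ℚ ℂ).injective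
  have h2 : (TensorProduct.mk ℚ ℂ Q 1 : Q →ₗ[ℚ] ℂ ⊗[ℚ] Q) =
      (Algebra.linearMap ℚ ℂ).rTensor Q ∘ₗ (TensorProduct.lid ℚ Q).symm.toLinearMap := by
    ext q
    simp
  rw [h2, LinearMap.coe_comp, LinearEquiv.coe_coe]
  exact h1.comp (TensorProduct.lid ℚ Q).symm.injective

/-- `1 ⊗ q ∈ p.baseChange ℂ` iff `q ∈ p` (`p.baseChange ℂ` is the range of `p.subtype ⊗ 1`; the base change of
the quotient map kills it and is injective on `1 ⊗ ·`). -/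
theorem mem_baseChange_mk_one_iff (p : Submodule ℚ Q) (q : Q) :
    (1 : ℂ) ⊗ₜ[ℚ] q ∈ p.baseChange ℂ ↔ q ∈ p := by
  constructor
  · intro hq
    have hker : p.baseChange ℂ ≤ LinearMap.ker (p.mkQ.baseChange ℂ) := by
      rw [Submodule.baseChange]
      rintro _ ⟨y, rfl⟩
      rw [LinearMap.mem_ker, ← LinearMap.comp_apply, ← LinearMap.baseChange_comp]
      have h0 : p.mkQ ∘ₗ p.subtype = 0 :=
        LinearMap.ext fun x => (Submodule.Quotient.mk_eq_zero p).2 x.2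
      rw [h0, LinearMap.baseChange_zero, LinearMap.zero_apply]
    have h0 := hker hq
    rw [LinearMap.mem_ker, LinearMap.baseChange_tmul, Submodule.mkQ_apply] at h0
    have h1 : TensorProduct.mk ℚ ℂ (Q ⧸ p) 1 (Submodule.Quotient.mk q) =
        TensorProduct.mk ℚ ℂ (Q ⧸ p) 1 0 := by
      rw [TensorProduct.mk_apply, TensorProduct.mk_apply, TensorProduct.tmul_zero]
      exact h0
    exact (Submodule.Quotient.mk_eq_zero p).1 (mk_one_injective h1)
  · intro hq
    rw [Submodule.baseChange]
    exact ⟨(1 : ℂ) ⊗ₜ[ℚ] ⟨q, hq⟩, by rw [LinearMap.baseChange_tmul]; rfl⟩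

/-- The projection onto the `i`-th summand of an internal direct sum, as an endomorphism. -/
def internalProj {ι : Type*} [DecidableEq ι] {R : ι → Submodule ℚ Q} (h : DirectSum.IsInternal R) (i : ι) :
    Q →ₗ[ℚ] Q :=
  (R i).subtype ∘ₗ (DirectSum.component ℚ ι (fun j => R j) i) ∘ₗ
    (LinearEquiv.ofBijective (DirectSum.coeLinearMap R) h).symm.toLinearMap

/-- The projection is the identity on the `i`-th summand and `0` on the others. -/
theorem internalProj_apply {ι : Type*} [DecidableEq ι] {R : ι → Submodule ℚ Q}
    (h : DirectSum.IsInternal R) (i j : ι) (r : Q) (hr : r ∈ R j) :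
    internalProj h i r = if j = i then r else 0 := by
  have hsymm : (LinearEquiv.ofBijective (DirectSum.coeLinearMap R) h).symm r =
      DirectSum.lof ℚ ι (fun j => R j) j ⟨r, hr⟩ := by
    apply (LinearEquiv.ofBijective (DirectSum.coeLinearMap R) h).injective
    rw [LinearEquiv.apply_symm_apply, LinearEquiv.ofBijective_apply, DirectSum.coeLinearMap_lof]
  simp only [internalProj, LinearMap.comp_apply, LinearEquiv.coe_coe, hsymm, Submodule.coe_subtype]
  by_cases hji : j = i
  · subst hji
    rw [DirectSum.component.lof_self, if_pos rfl]
  · rw [if_neg hji, DirectSum.component.of, dif_neg hji, Submodule.coe_zero]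

/-- BASE CHANGE OF AN INTERNAL DIRECT SUM: if the ranges of `f i : N i →ₗ[ℚ] Q` decompose `Q`, the
ranges of their base changes to `ℂ` decompose `ℂ ⊗[ℚ] Q`. -/
theorem isInternal_baseChange {ι : Type*} [Fintype ι] [DecidableEq ι] {N : ι → Type*}
    [∀ i, AddCommGroup (N i)] [∀ i, Module ℚ (N i)] (f : ∀ i, N i →ₗ[ℚ] Q)
    (h : DirectSum.IsInternal fun i => LinearMap.range (f i)) :
    DirectSum.IsInternal fun i => LinearMap.range ((f i).baseChange ℂ) := by
  classical
  obtain ⟨-, htop⟩ := (DirectSum.isInternal_submodule_iff_iSupIndep_and_iSup_eq_top _).1 h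
  -- the projections, base-changed
  have hproj : ∀ i j (x : ℂ ⊗[ℚ] N j),
      (internalProj h i).baseChange ℂ ((f j).baseChange ℂ x) = if j = i then (f j).baseChange ℂ x else 0 := by
    intro i j x
    have hcomp : internalProj h i ∘ₗ f j = if j = i then f j else 0 := by
      ext n
      rw [LinearMap.comp_apply, internalProj_apply h i j (f j n) (LinearMap.mem_range_self _ _)]
      split_ifs <;> rfl
    rw [← LinearMap.comp_apply, ← LinearMap.baseChange_comp, hcomp]
    split_ifs
    · rfl
    · rw [LinearMap.baseChange_zero, LinearMap.zero_apply]
  refine DirectSum.isInternal_submodule_of_iSupIndep_of_iSup_eq_top ?_ ?_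
  · rw [iSupIndep_def]
    intro i
    rw [Submodule.disjoint_def]
    intro x hx hx'
    -- `x` is killed by the `i`-th projection (it lies in the other summands) and fixed by it
    have hker : (⨆ j, ⨆ (_ : j ≠ i), LinearMap.range ((f j).baseChange ℂ)) ≤
        LinearMap.ker ((internalProj h i).baseChange ℂ) := by
      refine iSup_le fun j => iSup_le fun hji => ?_
      rintro _ ⟨y, rfl⟩
      rw [LinearMap.mem_ker, hproj, if_neg hji]
    have h0 : (internalProj h i).baseChange ℂ x = 0 := hker hx'
    obtain ⟨y, rfl⟩ := hx
    rw [hproj, if_pos rfl] at h0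
    exact h0
  · have key : ∀ x : ℂ ⊗[ℚ] Q, x ∈ ⨆ i, LinearMap.range ((f i).baseChange ℂ) := by
      intro x
      induction x using TensorProduct.induction_on with
      | zero => exact Submodule.zero_mem _
      | tmul c q =>
        have hq : q ∈ ⨆ i, LinearMap.range (f i) := by rw [htop]; exact Submodule.mem_top
        obtain ⟨g, hg, rfl⟩ := (Submodule.mem_iSup_iff_exists_finsupp _ _).1 hq
        rw [Finsupp.sum_fintype _ _ fun _ => rfl, TensorProduct.tmul_sum]
        refine Submodule.sum_mem _ fun i _ => Submodule.mem_iSup_of_mem i ?_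
        obtain ⟨n, hn⟩ := hg i
        exact ⟨c ⊗ₜ[ℚ] n, by rw [LinearMap.baseChange_tmul, hn]⟩
      | add x y hx hy => exact Submodule.add_mem _ hx hy
    rw [eq_top_iff]
    exact fun x _ => key x

end generic

/-! ## 2. The canonical rational structure of `ℂ ⊗[ℚ] Q` -/

section rat

variable {K : Type*} [Field K] [NumberField K] {Q : Type*} [AddCommGroup Q] [Module ℚ Q]

/-- The base change to `ℂ` of a rational action (the lead's `T6Host.baseChangeAct`, spelled out). -/
abbrev bcAct (act : K →+* Module.End ℚ Q) : K →+* Module.End ℂ (ℂ ⊗[ℚ] Q) :=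
  (Module.End.baseChangeHom ℚ ℂ Q).toRingHom.comp act

/-- The rational classes of `ℂ ⊗[ℚ] Q`: the range of `q ↦ 1 ⊗ q`. -/
abbrev ratC : Submodule ℚ (ℂ ⊗[ℚ] Q) := LinearMap.range (TensorProduct.mk ℚ ℂ Q 1)

omit [NumberField K] in
/-- `bcAct act x` on a pure tensor. -/
theorem bcAct_tmul (act : K →+* Module.End ℚ Q) (x : K) (c : ℂ) (q : Q) :
    bcAct act x (c ⊗ₜ[ℚ] q) = c ⊗ₜ[ℚ] act x q := by
  show (act x).baseChange ℂ (c ⊗ₜ[ℚ] q) = c ⊗ₜ[ℚ] act x q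
  rw [LinearMap.baseChange_tmul]

/-- THE CANONICAL RATIONAL STRUCTURE of the base change of a rational action (`T6A1DictRat.RatStructure`,
no display: `ℂ ⊗[ℚ] ratC ≃ ℂ ⊗[ℚ] Q` is the identity on pure tensors). -/
def ratHC (act : K →+* Module.End ℚ Q) : RatStructure (bcAct act) where
  R := ratC
  act_mem x _ hr := by
    obtain ⟨q, rfl⟩ := hr
    exact ⟨act x q, by rw [TensorProduct.mk_apply, TensorProduct.mk_apply, bcAct_tmul]⟩
  toV_bijective := by
    let e : Q ≃ₗ[ℚ] (ratC : Submodule ℚ (ℂ ⊗[ℚ] Q)) :=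
      LinearEquiv.ofInjective (TensorProduct.mk ℚ ℂ Q 1) mk_one_injective
    have key : ∀ y : ℂ ⊗[ℚ] Q, toV ratC (e.baseChange ℚ ℂ _ _ y) = y := by
      intro y
      induction y using TensorProduct.induction_on with
      | zero => simp
      | tmul c q =>
        rw [LinearEquiv.baseChange_tmul, toV_tmul]
        show c • ((1 : ℂ) ⊗ₜ[ℚ] q) = c ⊗ₜ[ℚ] q
        rw [TensorProduct.smul_tmul', smul_eq_mul, mul_one]
      | add a b ha hb => rw [map_add, map_add, ha, hb]
    have hcomp : toV (ratC : Submodule ℚ (ℂ ⊗[ℚ] Q)) = (e.baseChange ℚ ℂ _ _).symm.toLinearMap := by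
      apply LinearMap.ext
      intro z
      obtain ⟨y, rfl⟩ := (e.baseChange ℚ ℂ _ _).surjective z
      rw [key, LinearEquiv.coe_coe, LinearEquiv.symm_apply_apply]
    rw [hcomp, LinearEquiv.coe_coe]
    exact (e.baseChange ℚ ℂ _ _).symm.bijective

omit [NumberField K] in
/-- The pull-back `f ⊗ 1` preserves rational classes. -/
theorem baseChange_mem_ratC {Q' : Type*} [AddCommGroup Q'] [Module ℚ Q'] (f : Q' →ₗ[ℚ] Q)
    {r : ℂ ⊗[ℚ] Q'} (hr : r ∈ (ratC : Submodule ℚ (ℂ ⊗[ℚ] Q'))) : f.baseChange ℂ r ∈ ratC := by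
  obtain ⟨q, rfl⟩ := hr
  exact ⟨f q, by rw [TensorProduct.mk_apply, TensorProduct.mk_apply, LinearMap.baseChange_tmul]⟩

omit [NumberField K] in
/-- `(q : ℂ) • r` is rational for `r` rational. -/
theorem ratSmul_mem_ratC (q : ℚ) {r : ℂ ⊗[ℚ] Q}
    (hr : r ∈ (ratC : Submodule ℚ (ℂ ⊗[ℚ] Q))) : (q : ℂ) • r ∈ ratC := by
  obtain ⟨r, rfl⟩ := hr
  refine ⟨q • r, ?_⟩
  rw [TensorProduct.mk_apply, TensorProduct.mk_apply, TensorProduct.smul_tmul', smul_eq_mul, mul_one,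
    ← TensorProduct.smul_tmul, Rat.smul_one_eq_cast]

end rat


end Summit.Ventures.HodgeRepro2.T6.A1BaseChange

end
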